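import Summits.QuantumFields.YangMills.Theorems.UnitScaleTiltProp7Op349OfKernelRow
import Summits.QuantumFields.YangMills.Theorems.UnitScaleTiltProp7SectET3DeltaOneT3PInv
import Summits.QuantumFields.YangMills.Theorems.UnitScaleTiltProp7SectET3CurvedPropagatorsT3
import Literature.MathematicalPhysics.QuantumFieldTheory.Balaban1983to89.B3Taylor310LocalRemainder
import HarnessLib

/-!
# Route `UnitScaleTilt`, crux «MinimiserStabilityRegPr» (stmt-QuantumFields-19200), stub `stub_existenceMinimalOrbit` (EX), route (α) — DOOR «OPROW-137»:
# THE THREE DISPLAYED OPERATOR ROWS `h137π`, `h137Δ` ((137)'s block letter `Q_k†((QGQ†)⁻¹·) − Q_k†(a·)` at the two slots, coarse→fine sup rows) AND `hOpCΔ` (the tube term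
# `Q_k†(QGQ†)⁻¹Q_kG`, fine→fine sup row) OF S22ᴸ FROM PRINT'S POINTWISE KERNEL ROWS — [Balaban1985Variational] (137) p.298 «Δ_πH = … Q*(QGQ*)⁻¹B … − Q*aB, hence |Δ_πHB|₋₃ ≤ O(1)|B|»
# over [Balaban1985BackgroundPropagators] (3.124)–(3.126) p.420, Thm 3.3 p.399, Thm 3.12 (3.133) p.422 («the kernels … decay exponentially»), and (3.147)∕(3.153) pp.425–426 for the tube term —
# by Schur's row sum and the coarse-torus geometric series (★px6 g5 ✓`Prop7TorusExpWeightSum.sum_exp_neg_mul_tdist_le`; the fine→fine step is ✓`Prop7Op349OfKernelRow.sup_row_of_kernel_row`)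

Cell `ym3-torus`, width seat `ym3-torus-px5` (gen 4; FILL-TO-CAP «width 5»); EX namer ★ym-ust-19200-w2 g8 WORD (2) 2026-08-29T03:11:01Z «… THEN OPROW-137 GO ({h137π, h137Δ, hOpCΔ} …)»;
LOCATE memo `HOME/ym3-torus-px5/g4/LOCATE-OPROW-SOCKET-px5g4.md` (19200 evidence #56) §V3.  THEOREMS ONLY (0 `def`, 0 `sorry`); `--supports stmt-QuantumFields-19200 --as helper`;
count-neutral.  YM₃ on T³ is ladder rung R3, NOT the Clay problem; nothing here is a claim about the stub, the crux, d = 4 or the mass gap; NOTHING of print's estimates is asserted — the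
three pointwise kernel rows are DISPLAYED hypotheses (N06 class, print's sentences with locators), this file only INTEGRATES them.

LETTER CHOICE (why the kernel rows are stated for print's COMPOSITES and not for the bare `(QGQ†)⁻¹`).  In the display's weight convention (`c₀ cB : ℕ → ℝ` L-only, `a L i` member-scaled —
★px6 (V2)), `Q_k† = (cB∕c₀)·Q_kᵀ` and `KinvT = (Q_kGQ_k†)⁻¹` carries the reciprocal factor `(c₀∕cB)·(L^{K−n})³` relative to print's `(QGQ*)⁻¹` (print: `c₀ = η³`, `cB = 1`); the COMPOSITES
`Q_k†(QGQ_k†)⁻¹` and `Q_k†(a·)` are convention-free and are exactly the objects print bounds in (137) («Q*(QGQ*)⁻¹B − Q*aB») and in (133)∕(3.147) (the tube term of `𝔓`).  So the displayed-to-be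
rows are: `h137kπ`∕`h137kΔ` — the coarse→fine kernel of the (137) letter, entries `O(1)·e^{−δ·d(B^{K−n}(b), ŷ)}` (the currency of ★px6's `h133`, no `η`-power: coarse column, fine row); `hCk` —
the fine→fine kernel of the tube term, entries `O(η³)·e^{−δ·d(B^{K−n}(b), B^{K−n}(bd))}` (the currency of `h349`, (3.11)'s `η^d`).

WHAT IS PROVED (ns `…Theorems.Prop7Op137OfKernelRows`).
* §1 `tdist` symmetry by name (lit ✓`B3Taylor310LocalRemainder.tdist_comm`), ★ `sum_coarse_pbond_exp_neg_tdist_le` (`Σ_{y : coarse bonds} e^{−a·tdist(x₀, ŷ)} ≤ 3·(2(1+1∕a))³`, volume-free),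
  ★★ `sup_row_of_coarse_kernel_row` — THE GENERIC COARSE→FINE SCHUR STEP: an ADDITIVE `T` from the coarse one-forms to the fine ones with `‖T(δ_y Z)(b)‖ ≤ C·e^{−a·tdist(B^{K−n}(b), ŷ)}·‖Z‖`
  has `‖T Y b‖ ≤ 3C(2(1+1∕a))³·‖Y‖` (sup norm of `Y`).
* §2 ★★★ `h137_of_kernel137_family_slot` — GENERIC SLOT `Δx L i`: the (137) sup row at `KinvT … (Δx L i) U₀` ⟸ its pointwise kernel row; ★★★ `h137π_of_kernel137_family` (slot `DeltaPiSlotP`, S22ᴸ's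
  `h137π` TOKEN FOR TOKEN, `c137π L := 3·CKπ L·(2(1+1∕δKπ L))³`), ★★★ `h137Δ_of_kernel137_family` (slot `DeltaEtaSlot + TJSlotP`, S22ᴸ's `h137` TOKEN FOR TOKEN, `c137 L := 3·CKΔ L·(2(1+1∕δKΔ L))³`);
  ★★★ `hOpC_of_kernelC_family` — S22ᴸ's `hOpC` TOKEN FOR TOKEN with `cC L := 3·CC L·(2(1+1∕δC L))³` from the fine→fine kernel row `hCk` via ✓`sup_row_of_kernel_row`.  The display's sign
  conjuncts `0 ≤ c137π L`, `0 ≤ cC L`, `0 ≤ c137 L` at these letters are ✓`Prop7Op349OfKernelRow.k349_nonneg` BY NAME (same text).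
HONEST SCOPE.  Linearity + triangle inequality + ★px6's counting lemmas; no analysis.  FLAT-MEMBER CERTIFICATES (named, not typed): at `U₀ = 1` the Gram operator `Q(1)G(1)Q(1)†` and its inverse
have explicit Fourier kernels — lit ✓`B9Eq349FlatQGGQInvKernel`, ✓`B9Thm314QGQInvFlatV1…` (pointwise flat kernels of the Gram inverses), ★px21 g5 «`Qk(1)†` = TENT» (the flat adjoint's
support letter); `G(1)` at the slot `Δ^η + T_Jᴾ(1) = Δ^η` (`T_Jᴾ(1) = 0`, ✓`TJP_eq_zero_of_actionGrad_eq_zero` twin) is the flat massive propagator of ★px6 ✓`Prop7LaplaceAFlatCoercive` — the three rows are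
inhabitable at the flat member in the (3.133) class; not by `exact` tonight.  Nothing of Thm 3.3∕3.12, EX, the crux; nothing continuum ∕ OS ∕ mass-gap ∕ Clay.

References: T. Bałaban, CMP **99** (1985) 389–434 [Balaban1985BackgroundPropagators] ((3.11) p.392, (3.124)–(3.126) p.420, (3.133) p.422, Thm 3.3 p.399, Thm 3.12 p.423, (3.147)–(3.153) pp.425–426);
CMP **102** (1985) 277–309 [Balaban1985Variational] ((130)–(137) p.298, p.299); CMP **96** (1984) 223–250 [Balaban1984PropagatorsII] ((2.61) p.234).
-/

set_option autoImplicit false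

noncomputable section

open scoped Matrix.Norms.L2Operator BigOperators InnerProductSpace ComplexConjugate

namespace Summit.QuantumFields.YangMills.Theorems.Prop7Op137OfKernelRows

open Literature.MathematicalPhysics.QuantumFieldTheory.Balaban1983to89
open Literature.MathematicalPhysics.QuantumFieldTheory.Balaban1983to89.T3ContinuumYM3Torus
open Literature.MathematicalPhysics.QuantumFieldTheory.Balaban1983to89.T3Thm1Carrier
open T3PrintedRegularMinimiser (RegPr)
open T3PrintedRegularOrbits (sites_eq)
open T3LevelShift (siteShift)
open B3Taylor310LocalRemainder (tdist_comm)
open B5Eq118OneStroke (iterBlockOf)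
open B11Eq103H1Complex (BondL2K)
open Summit.QuantumFields.YangMills.Theorems.Prop7SectET3Transport (periodsT3)
open Summit.QuantumFields.YangMills.Theorems.Prop7SectET3HilbertLetters (W₂ toL2 toL2B)
open Summit.QuantumFields.YangMills.Theorems.Prop7SectET3WilsonHessian (DeltaEtaSlot)
open Summit.QuantumFields.YangMills.Theorems.Prop7SectET3CurvedPropagators (Qk GT KinvT)
open Summit.QuantumFields.YangMills.Theorems.Prop7SectET3DeltaPiPInv (DeltaPiSlotP)
open Summit.QuantumFields.YangMills.Theorems.Prop7SectET3DeltaOnePInv (TJSlotP)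
open Summit.QuantumFields.YangMills.Theorems.Prop7BlockBumpExtension (sum_pbond_eq)
open Summit.QuantumFields.YangMills.Theorems.Prop7TorusExpWeightSum (sum_exp_neg_mul_tdist_le)
open Summit.QuantumFields.YangMills.Theorems.Prop7Op349OfKernelRow (sup_row_of_kernel_row)

/-! ## §1 The generic coarse→fine Schur step at a member -/

section Schur

variable (F : T3Family) (n K : ℕ) (h : n ≤ K)

/-- ★ **THE COARSE COUNTING FACT**: `Σ_{y : PBond (F.P n) 0} e^{−a·tdist(x₀, ŷ)} ≤ 3·(2(1+1∕a))³` — three directions per coarse site, the coarse sites moved to the member's `(K−n)`-level by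
`siteShift`, then ★px6's torus geometric series. [cite: Balaban1984PropagatorsII, (2.61) p.234] -/
theorem sum_coarse_pbond_exp_neg_tdist_le (x₀ : Site (F.P K) (K - n)) {a : ℝ} (ha : 0 < a) :
    ∑ y : PBond (F.P n) 0, Real.exp (-(a * (Site.tdist x₀ (siteShift (sites_eq F n K h) y.src) : ℝ))) ≤ 3 * (2 * (1 + 1 / a)) ^ 3 := by
  rw [sum_pbond_eq (P := F.P n) (fun y : PBond (F.P n) 0 => Real.exp (-(a * (Site.tdist x₀ (siteShift (sites_eq F n K h) y.src) : ℝ))))]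
  simp only [Finset.sum_const, Finset.card_univ, Fintype.card_fin, nsmul_eq_mul]
  have hd : (F.P n).d = 3 := rfl
  have hdK : (F.P K).d = 3 := rfl
  rw [← Finset.mul_sum, hd, Nat.cast_ofNat]
  have hshift : ∑ x : Site (F.P n) 0, Real.exp (-(a * (Site.tdist x₀ (siteShift (sites_eq F n K h) x) : ℝ)))
      = ∑ z : Site (F.P K) (K - n), Real.exp (-(a * (Site.tdist z x₀ : ℝ))) :=
    Fintype.sum_equiv (siteShift (sites_eq F n K h))
      (fun x : Site (F.P n) 0 => Real.exp (-(a * (Site.tdist x₀ (siteShift (sites_eq F n K h) x) : ℝ))))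
      (fun z : Site (F.P K) (K - n) => Real.exp (-(a * (Site.tdist z x₀ : ℝ)))) (fun x => by rw [tdist_comm])
  rw [hshift]
  have hs := sum_exp_neg_mul_tdist_le (P := F.P K) (j := K - n) x₀ ha
  rw [hdK] at hs
  linarith

variable {F n K h}

/-- ★★ **THE GENERIC COARSE→FINE SCHUR STEP**: an ADDITIVE map `T` from the coarse one-forms to the fine ones with the pointwise kernel bound
`‖T(δ_y Z)(b)‖ ≤ C·e^{−a·tdist(B^{K−n}(b), ŷ)}·‖Z‖` (`0 ≤ C`, `0 < a`) satisfies `‖(T Y)(b)‖ ≤ 3C(2(1+1∕a))³·‖Y‖` for every `Y` (sup norm) — the (137)∕(3.133)-type row sum over the coarse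
bonds. [cite: Balaban1985BackgroundPropagators, (3.133) p.422, (3.124)–(3.126) p.420; Balaban1985Variational, (137) p.298] -/
theorem sup_row_of_coarse_kernel_row (T : (PBond (F.P n) 0 → Matrix (Fin 2) (Fin 2) ℂ) →+ (PBond (F.P K) 0 → Matrix (Fin 2) (Fin 2) ℂ)) {C a : ℝ} (hC : 0 ≤ C) (ha : 0 < a)
    (hT : ∀ (y : PBond (F.P n) 0) (Z : Matrix (Fin 2) (Fin 2) ℂ) (b : PBond (F.P K) 0),
      ‖T (Pi.single y Z) b‖ ≤ C * Real.exp (-(a * (Site.tdist (iterBlockOf (K - n) b.src) (siteShift (sites_eq F n K h) y.src) : ℝ))) * ‖Z‖)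
    (Y : PBond (F.P n) 0 → Matrix (Fin 2) (Fin 2) ℂ) (b : PBond (F.P K) 0) :
    ‖T Y b‖ ≤ 3 * C * (2 * (1 + 1 / a)) ^ 3 * ‖Y‖ := by
  classical
  have hX' : T Y b = ∑ y : PBond (F.P n) 0, T (Pi.single y (Y y)) b := by
    conv_lhs => rw [← Finset.univ_sum_single Y]
    rw [map_sum, Finset.sum_apply]
  rw [hX']
  refine (norm_sum_le _ _).trans ?_
  have hterm : ∀ y : PBond (F.P n) 0, ‖T (Pi.single y (Y y)) b‖
      ≤ (C * ‖Y‖) * Real.exp (-(a * (Site.tdist (iterBlockOf (K - n) b.src) (siteShift (sites_eq F n K h) y.src) : ℝ))) := by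
    intro y
    refine (hT y (Y y) b).trans ?_
    have h1 : C * Real.exp (-(a * (Site.tdist (iterBlockOf (K - n) b.src) (siteShift (sites_eq F n K h) y.src) : ℝ))) * ‖Y y‖
        ≤ C * Real.exp (-(a * (Site.tdist (iterBlockOf (K - n) b.src) (siteShift (sites_eq F n K h) y.src) : ℝ))) * ‖Y‖ :=
      mul_le_mul_of_nonneg_left (norm_le_pi_norm Y y) (by positivity)
    linarith [h1]
  refine (Finset.sum_le_sum fun y _ => hterm y).trans ?_
  rw [← Finset.mul_sum]
  have hsum := sum_coarse_pbond_exp_neg_tdist_le F n K h (iterBlockOf (K - n) b.src) ha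
  have hcoef : 0 ≤ C * ‖Y‖ := by positivity
  calc C * ‖Y‖ * ∑ y : PBond (F.P n) 0, Real.exp (-(a * (Site.tdist (iterBlockOf (K - n) b.src) (siteShift (sites_eq F n K h) y.src) : ℝ)))
      ≤ C * ‖Y‖ * (3 * (2 * (1 + 1 / a)) ^ 3) := mul_le_mul_of_nonneg_left hsum hcoef
    _ = 3 * C * (2 * (1 + 1 / a)) ^ 3 * ‖Y‖ := by ring

end Schur

/-! ## §2 The doors at the EX display's letters -/

section Family

/-- ★★★ **DOOR «OPROW-137», GENERIC SLOT**: the (137) sup row «`‖toL2⁻¹(Q_k†((QGQ_k†)⁻¹_{Δx}(toL2B Y)) − Q_k†(a•toL2B Y))(b)‖ ≤ c·‖Y‖`» at the slot `KinvT … (Δx L i) U₀` from the pointwise kernel row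
of the SAME composite letter, `c := 3·CK L·(2(1+1∕δK L))³` — coarse Schur. [cite: Balaban1985Variational, (137) p.298; Balaban1985BackgroundPropagators, (3.124)–(3.126) p.420, Thm 3.12 p.423] -/
theorem h137_of_kernel137_family_slot
    (α : ℕ → ℝ) (c₀ cB : ℕ → ℝ) [hc₀ : ∀ L : ℕ, Fact (0 < c₀ L)] [hcB : ∀ L : ℕ, Fact (0 < cB L)] (a : ∀ L : ℕ, Idx L → ℝ)
    (Δx : ∀ (L : ℕ) (i : Idx L), GaugeField (i.1.1.P i.1.2.2) 0 (Matrix.specialUnitaryGroup (Fin 2) ℂ) →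
      (BondL2K ℂ 3 (periodsT3 i.1.1 i.1.2.2) (c₀ L) W₂ →ₗ[ℂ] BondL2K ℂ 3 (periodsT3 i.1.1 i.1.2.2) (c₀ L) W₂))
    (CK δK : ℕ → ℝ) (hCK : ∀ L, 1 < L → 0 ≤ CK L) (hδK : ∀ L, 1 < L → 0 < δK L)
    (h137k : ∀ (L : ℕ), 1 < L → ∀ (i : Idx L) (U₀ : GaugeField (i.1.1.P i.1.2.2) 0 (Matrix.specialUnitaryGroup (Fin 2) ℂ)), RegPr i.1.1 i.1.2.1 i.1.2.2 (α L) U₀ →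
      ∀ (y : PBond (i.1.1.P i.1.2.1) 0) (Z : Matrix (Fin 2) (Fin 2) ℂ) (b : PBond (i.1.1.P i.1.2.2) 0),
        ‖(toL2 i.1.1 i.1.2.2 (c₀ L)).symm (LinearMap.adjoint (Qk i.1.1 i.1.2.1 i.1.2.2 i.2.2.le (c₀ L) (cB L) U₀) (KinvT i.1.1 i.1.2.1 i.1.2.2 i.2.2.le (c₀ L) (cB L) (a L i) (Δx L i) U₀ (toL2B i.1.1 i.1.2.1 (cB L) (Pi.single y Z)))
            - LinearMap.adjoint (Qk i.1.1 i.1.2.1 i.1.2.2 i.2.2.le (c₀ L) (cB L) U₀) (((a L i : ℂ)) • toL2B i.1.1 i.1.2.1 (cB L) (Pi.single y Z))) b‖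
          ≤ CK L * Real.exp (-(δK L * (Site.tdist (iterBlockOf (i.1.2.2 - i.1.2.1) b.src) (siteShift (sites_eq i.1.1 i.1.2.1 i.1.2.2 i.2.2.le) y.src) : ℝ))) * ‖Z‖) :
    ∀ (L : ℕ), 1 < L → ∀ (i : Idx L) (U₀ : GaugeField (i.1.1.P i.1.2.2) 0 (Matrix.specialUnitaryGroup (Fin 2) ℂ)), RegPr i.1.1 i.1.2.1 i.1.2.2 (α L) U₀ →
      ∀ (Y : PBond (i.1.1.P i.1.2.1) 0 → Matrix (Fin 2) (Fin 2) ℂ) (b : PBond (i.1.1.P i.1.2.2) 0),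
        ‖(toL2 i.1.1 i.1.2.2 (c₀ L)).symm (LinearMap.adjoint (Qk i.1.1 i.1.2.1 i.1.2.2 i.2.2.le (c₀ L) (cB L) U₀) (KinvT i.1.1 i.1.2.1 i.1.2.2 i.2.2.le (c₀ L) (cB L) (a L i) (Δx L i) U₀ (toL2B i.1.1 i.1.2.1 (cB L) Y))
            - LinearMap.adjoint (Qk i.1.1 i.1.2.1 i.1.2.2 i.2.2.le (c₀ L) (cB L) U₀) (((a L i : ℂ)) • toL2B i.1.1 i.1.2.1 (cB L) Y)) b‖ ≤ (3 * CK L * (2 * (1 + 1 / δK L)) ^ 3) * ‖Y‖ := by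
  intro L hL i U₀ hreg Y b
  -- the composite (137) letter as a `ℂ`-linear map coarse → fine
  let Tlin : (PBond (i.1.1.P i.1.2.1) 0 → Matrix (Fin 2) (Fin 2) ℂ) →ₗ[ℂ] (PBond (i.1.1.P i.1.2.2) 0 → Matrix (Fin 2) (Fin 2) ℂ) :=
    (toL2 i.1.1 i.1.2.2 (c₀ L)).symm.toLinearMap ∘ₗ
      ((LinearMap.adjoint (Qk i.1.1 i.1.2.1 i.1.2.2 i.2.2.le (c₀ L) (cB L) U₀) ∘ₗ KinvT i.1.1 i.1.2.1 i.1.2.2 i.2.2.le (c₀ L) (cB L) (a L i) (Δx L i) U₀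
          - LinearMap.adjoint (Qk i.1.1 i.1.2.1 i.1.2.2 i.2.2.le (c₀ L) (cB L) U₀) ∘ₗ (((a L i : ℂ)) • LinearMap.id)) ∘ₗ (toL2B i.1.1 i.1.2.1 (cB L)).toLinearMap)
  have hTlin : ∀ W : PBond (i.1.1.P i.1.2.1) 0 → Matrix (Fin 2) (Fin 2) ℂ, Tlin W
      = (toL2 i.1.1 i.1.2.2 (c₀ L)).symm (LinearMap.adjoint (Qk i.1.1 i.1.2.1 i.1.2.2 i.2.2.le (c₀ L) (cB L) U₀) (KinvT i.1.1 i.1.2.1 i.1.2.2 i.2.2.le (c₀ L) (cB L) (a L i) (Δx L i) U₀ (toL2B i.1.1 i.1.2.1 (cB L) W))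
            - LinearMap.adjoint (Qk i.1.1 i.1.2.1 i.1.2.2 i.2.2.le (c₀ L) (cB L) U₀) (((a L i : ℂ)) • toL2B i.1.1 i.1.2.1 (cB L) W)) := by
    intro W
    simp only [Tlin, LinearMap.coe_comp, Function.comp_apply, LinearEquiv.coe_toLinearMap, LinearMap.sub_apply, LinearMap.smul_apply, LinearMap.id_apply]
  have h := sup_row_of_coarse_kernel_row (F := i.1.1) (n := i.1.2.1) (K := i.1.2.2) (h := i.2.2.le) Tlin.toAddMonoidHom (hCK L hL) (hδK L hL)
    (fun y Z b' => by
      rw [LinearMap.toAddMonoidHom_coe, hTlin]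
      exact h137k L hL i U₀ hreg y Z b') Y b
  rw [LinearMap.toAddMonoidHom_coe, hTlin] at h
  exact h

/-- ★★★ **DOOR «OPROW-137» AT THE SLOT `Δ_πᴾ`: S22ᴸ's DISPLAYED ROW `h137π` TOKEN FOR TOKEN**, `c137π L := 3·CKπ L·(2(1+1∕δKπ L))³`, from the displayed-to-be pointwise kernel row `h137kπ` of the (137)
letter `Q_k†((QGQ_k†)⁻¹_{Δ_πᴾ}·) − Q_k†(a·)` (print's «Q*(QGQ*)⁻¹B − Q*aB» for `H = H46P`; kernel class of [B9] Thm 3.12∕(3.124)–(3.126), coarse column → fine row, distance = coarse-block ℓ¹ torus distance).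
[cite: Balaban1985Variational, (137) p.298, (45)–(46) p.285; Balaban1985BackgroundPropagators, (3.124)–(3.126) p.420, Thm 3.12 p.423] -/
theorem h137π_of_kernel137_family
    (α : ℕ → ℝ) (c₀ cB : ℕ → ℝ) [hc₀ : ∀ L : ℕ, Fact (0 < c₀ L)] [hcB : ∀ L : ℕ, Fact (0 < cB L)] (a : ∀ L : ℕ, Idx L → ℝ)
    (CKπ δKπ : ℕ → ℝ) (hCKπ : ∀ L, 1 < L → 0 ≤ CKπ L) (hδKπ : ∀ L, 1 < L → 0 < δKπ L)
    (h137kπ : ∀ (L : ℕ), 1 < L → ∀ (i : Idx L) (U₀ : GaugeField (i.1.1.P i.1.2.2) 0 (Matrix.specialUnitaryGroup (Fin 2) ℂ)), RegPr i.1.1 i.1.2.1 i.1.2.2 (α L) U₀ →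
      ∀ (y : PBond (i.1.1.P i.1.2.1) 0) (Z : Matrix (Fin 2) (Fin 2) ℂ) (b : PBond (i.1.1.P i.1.2.2) 0),
        ‖(toL2 i.1.1 i.1.2.2 (c₀ L)).symm (LinearMap.adjoint (Qk i.1.1 i.1.2.1 i.1.2.2 i.2.2.le (c₀ L) (cB L) U₀) (KinvT i.1.1 i.1.2.1 i.1.2.2 i.2.2.le (c₀ L) (cB L) (a L i) (DeltaPiSlotP i.1.1 i.1.2.1 i.1.2.2 i.2.2.le (c₀ L) (cB L) (a L i)) U₀ (toL2B i.1.1 i.1.2.1 (cB L) (Pi.single y Z)))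
            - LinearMap.adjoint (Qk i.1.1 i.1.2.1 i.1.2.2 i.2.2.le (c₀ L) (cB L) U₀) (((a L i : ℂ)) • toL2B i.1.1 i.1.2.1 (cB L) (Pi.single y Z))) b‖
          ≤ CKπ L * Real.exp (-(δKπ L * (Site.tdist (iterBlockOf (i.1.2.2 - i.1.2.1) b.src) (siteShift (sites_eq i.1.1 i.1.2.1 i.1.2.2 i.2.2.le) y.src) : ℝ))) * ‖Z‖) :
    ∀ (L : ℕ), 1 < L → ∀ (i : Idx L) (U₀ : GaugeField (i.1.1.P i.1.2.2) 0 (Matrix.specialUnitaryGroup (Fin 2) ℂ)), RegPr i.1.1 i.1.2.1 i.1.2.2 (α L) U₀ →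
      ∀ (Y : PBond (i.1.1.P i.1.2.1) 0 → Matrix (Fin 2) (Fin 2) ℂ) (b : PBond (i.1.1.P i.1.2.2) 0),
        ‖(toL2 i.1.1 i.1.2.2 (c₀ L)).symm (LinearMap.adjoint (Qk i.1.1 i.1.2.1 i.1.2.2 i.2.2.le (c₀ L) (cB L) U₀) (KinvT i.1.1 i.1.2.1 i.1.2.2 i.2.2.le (c₀ L) (cB L) (a L i) (DeltaPiSlotP i.1.1 i.1.2.1 i.1.2.2 i.2.2.le (c₀ L) (cB L) (a L i)) U₀ (toL2B i.1.1 i.1.2.1 (cB L) Y))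
            - LinearMap.adjoint (Qk i.1.1 i.1.2.1 i.1.2.2 i.2.2.le (c₀ L) (cB L) U₀) (((a L i : ℂ)) • toL2B i.1.1 i.1.2.1 (cB L) Y)) b‖ ≤ (3 * CKπ L * (2 * (1 + 1 / δKπ L)) ^ 3) * ‖Y‖ :=
  h137_of_kernel137_family_slot α c₀ cB a (fun L i => DeltaPiSlotP i.1.1 i.1.2.1 i.1.2.2 i.2.2.le (c₀ L) (cB L) (a L i)) CKπ δKπ hCKπ hδKπ h137kπ

/-- ★★★ **DOOR «OPROW-137» AT THE OPERATOR SLOT `Δ^η + T_Jᴾ`: S22ᴸ's DISPLAYED ROW `h137` (a.k.a. `h137Δ`) TOKEN FOR TOKEN**, `c137 L := 3·CKΔ L·(2(1+1∕δKΔ L))³`, from the displayed-to-be pointwise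
kernel row `h137kΔ` of the (137) letter at the operator slot (print's «Q*(QGQ*)⁻¹B − Q*aB» for `H₀` of (129)–(130)).
[cite: Balaban1985Variational, (130)–(137) p.298; Balaban1985BackgroundPropagators, (3.124)–(3.126) p.420, Thm 3.12 p.423] -/
theorem h137Δ_of_kernel137_family
    (α : ℕ → ℝ) (c₀ cB : ℕ → ℝ) [hc₀ : ∀ L : ℕ, Fact (0 < c₀ L)] [hcB : ∀ L : ℕ, Fact (0 < cB L)] (a : ∀ L : ℕ, Idx L → ℝ)
    (CKΔ δKΔ : ℕ → ℝ) (hCKΔ : ∀ L, 1 < L → 0 ≤ CKΔ L) (hδKΔ : ∀ L, 1 < L → 0 < δKΔ L)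
    (h137kΔ : ∀ (L : ℕ), 1 < L → ∀ (i : Idx L) (U₀ : GaugeField (i.1.1.P i.1.2.2) 0 (Matrix.specialUnitaryGroup (Fin 2) ℂ)), RegPr i.1.1 i.1.2.1 i.1.2.2 (α L) U₀ →
      ∀ (y : PBond (i.1.1.P i.1.2.1) 0) (Z : Matrix (Fin 2) (Fin 2) ℂ) (b : PBond (i.1.1.P i.1.2.2) 0),
        ‖(toL2 i.1.1 i.1.2.2 (c₀ L)).symm (LinearMap.adjoint (Qk i.1.1 i.1.2.1 i.1.2.2 i.2.2.le (c₀ L) (cB L) U₀) (KinvT i.1.1 i.1.2.1 i.1.2.2 i.2.2.le (c₀ L) (cB L) (a L i) ((DeltaEtaSlot i.1.1 i.1.2.1 i.1.2.2 (c₀ L) + TJSlotP i.1.1 i.1.2.1 i.1.2.2 i.2.2.le (c₀ L) (cB L) (a L i))) U₀ (toL2B i.1.1 i.1.2.1 (cB L) (Pi.single y Z)))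
            - LinearMap.adjoint (Qk i.1.1 i.1.2.1 i.1.2.2 i.2.2.le (c₀ L) (cB L) U₀) (((a L i : ℂ)) • toL2B i.1.1 i.1.2.1 (cB L) (Pi.single y Z))) b‖
          ≤ CKΔ L * Real.exp (-(δKΔ L * (Site.tdist (iterBlockOf (i.1.2.2 - i.1.2.1) b.src) (siteShift (sites_eq i.1.1 i.1.2.1 i.1.2.2 i.2.2.le) y.src) : ℝ))) * ‖Z‖) :
    ∀ (L : ℕ), 1 < L → ∀ (i : Idx L) (U₀ : GaugeField (i.1.1.P i.1.2.2) 0 (Matrix.specialUnitaryGroup (Fin 2) ℂ)), RegPr i.1.1 i.1.2.1 i.1.2.2 (α L) U₀ →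
      ∀ (Y : PBond (i.1.1.P i.1.2.1) 0 → Matrix (Fin 2) (Fin 2) ℂ) (b : PBond (i.1.1.P i.1.2.2) 0),
        ‖(toL2 i.1.1 i.1.2.2 (c₀ L)).symm (LinearMap.adjoint (Qk i.1.1 i.1.2.1 i.1.2.2 i.2.2.le (c₀ L) (cB L) U₀) (KinvT i.1.1 i.1.2.1 i.1.2.2 i.2.2.le (c₀ L) (cB L) (a L i) ((DeltaEtaSlot i.1.1 i.1.2.1 i.1.2.2 (c₀ L) + TJSlotP i.1.1 i.1.2.1 i.1.2.2 i.2.2.le (c₀ L) (cB L) (a L i))) U₀ (toL2B i.1.1 i.1.2.1 (cB L) Y))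
            - LinearMap.adjoint (Qk i.1.1 i.1.2.1 i.1.2.2 i.2.2.le (c₀ L) (cB L) U₀) (((a L i : ℂ)) • toL2B i.1.1 i.1.2.1 (cB L) Y)) b‖ ≤ (3 * CKΔ L * (2 * (1 + 1 / δKΔ L)) ^ 3) * ‖Y‖ :=
  h137_of_kernel137_family_slot α c₀ cB a
    (fun L i => (DeltaEtaSlot i.1.1 i.1.2.1 i.1.2.2 (c₀ L) + TJSlotP i.1.1 i.1.2.1 i.1.2.2 i.2.2.le (c₀ L) (cB L) (a L i))) CKΔ δKΔ hCKΔ hδKΔ h137kΔ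

/-- ★★★ **DOOR «OPROW-C»: S22ᴸ's DISPLAYED TUBE-TERM ROW `hOpC` (a.k.a. `hOpCΔ`) TOKEN FOR TOKEN**, `cC L := 3·CC L·(2(1+1∕δC L))³`, from the displayed-to-be fine→fine pointwise kernel row `hCk` of the tube
composite `Q_k†(QGQ_k†)⁻¹Q_kG` at the operator slot (entries `O(η³)e^{−δ·d}`, (3.11)'s `η^d`; print's tube term of `𝔓` (3.147), bounded through Thm 3.3 and the Gram-inverse kernels, p.426) — by the
fine Schur step ✓`Prop7Op349OfKernelRow.sup_row_of_kernel_row`. [cite: Balaban1985BackgroundPropagators, (3.147)–(3.153) pp.425–426, Thm 3.3 p.399, (3.11) p.392; Balaban1985Variational, (133) p.298] -/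
theorem hOpC_of_kernelC_family
    (α : ℕ → ℝ) (c₀ cB : ℕ → ℝ) [hc₀ : ∀ L : ℕ, Fact (0 < c₀ L)] [hcB : ∀ L : ℕ, Fact (0 < cB L)] (a : ∀ L : ℕ, Idx L → ℝ)
    (CC δC : ℕ → ℝ) (hCC : ∀ L, 1 < L → 0 ≤ CC L) (hδC : ∀ L, 1 < L → 0 < δC L)
    (hCk : ∀ (L : ℕ), 1 < L → ∀ (i : Idx L) (U₀ : GaugeField (i.1.1.P i.1.2.2) 0 (Matrix.specialUnitaryGroup (Fin 2) ℂ)), RegPr i.1.1 i.1.2.1 i.1.2.2 (α L) U₀ →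
      ∀ (b : PBond (i.1.1.P i.1.2.2) 0) (Z : Matrix (Fin 2) (Fin 2) ℂ) (bd : PBond (i.1.1.P i.1.2.2) 0),
        ‖(toL2 i.1.1 i.1.2.2 (c₀ L)).symm (LinearMap.adjoint (Qk i.1.1 i.1.2.1 i.1.2.2 i.2.2.le (c₀ L) (cB L) U₀) (KinvT i.1.1 i.1.2.1 i.1.2.2 i.2.2.le (c₀ L) (cB L) (a L i) ((DeltaEtaSlot i.1.1 i.1.2.1 i.1.2.2 (c₀ L) + TJSlotP i.1.1 i.1.2.1 i.1.2.2 i.2.2.le (c₀ L) (cB L) (a L i))) U₀ (Qk i.1.1 i.1.2.1 i.1.2.2 i.2.2.le (c₀ L) (cB L) U₀ (GT i.1.1 i.1.2.1 i.1.2.2 i.2.2.le (c₀ L) (cB L) (a L i) ((DeltaEtaSlot i.1.1 i.1.2.1 i.1.2.2 (c₀ L) + TJSlotP i.1.1 i.1.2.1 i.1.2.2 i.2.2.le (c₀ L) (cB L) (a L i))) U₀ (toL2 i.1.1 i.1.2.2 (c₀ L) (Pi.single b Z)))))) bd‖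
          ≤ CC L * ((L : ℝ) ^ (i.1.2.2 - i.1.2.1))⁻¹ ^ 3 * Real.exp (-(δC L * (Site.tdist (iterBlockOf (i.1.2.2 - i.1.2.1) b.src) (iterBlockOf (i.1.2.2 - i.1.2.1) bd.src) : ℝ))) * ‖Z‖) :
    ∀ (L : ℕ), 1 < L → ∀ (i : Idx L) (U₀ : GaugeField (i.1.1.P i.1.2.2) 0 (Matrix.specialUnitaryGroup (Fin 2) ℂ)), RegPr i.1.1 i.1.2.1 i.1.2.2 (α L) U₀ →
      ∀ (x : BondL2K ℂ 3 (periodsT3 i.1.1 i.1.2.2) (c₀ L) W₂) (bd : PBond (i.1.1.P i.1.2.2) 0),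
        ‖(toL2 i.1.1 i.1.2.2 (c₀ L)).symm (LinearMap.adjoint (Qk i.1.1 i.1.2.1 i.1.2.2 i.2.2.le (c₀ L) (cB L) U₀) (KinvT i.1.1 i.1.2.1 i.1.2.2 i.2.2.le (c₀ L) (cB L) (a L i) ((DeltaEtaSlot i.1.1 i.1.2.1 i.1.2.2 (c₀ L) + TJSlotP i.1.1 i.1.2.1 i.1.2.2 i.2.2.le (c₀ L) (cB L) (a L i))) U₀ (Qk i.1.1 i.1.2.1 i.1.2.2 i.2.2.le (c₀ L) (cB L) U₀ (GT i.1.1 i.1.2.1 i.1.2.2 i.2.2.le (c₀ L) (cB L) (a L i) ((DeltaEtaSlot i.1.1 i.1.2.1 i.1.2.2 (c₀ L) + TJSlotP i.1.1 i.1.2.1 i.1.2.2 i.2.2.le (c₀ L) (cB L) (a L i))) U₀ x)))) bd‖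
          ≤ (3 * CC L * (2 * (1 + 1 / δC L)) ^ 3) * ‖(toL2 i.1.1 i.1.2.2 (c₀ L)).symm x‖ := by
  intro L hL i U₀ hreg x bd
  have hFL' : (i.1.1.L : ℝ) = (L : ℝ) := by rw [i.2.1]
  -- the tube composite as a `ℂ`-linear map fine → fine (on the function side)
  let Tlin : (PBond (i.1.1.P i.1.2.2) 0 → Matrix (Fin 2) (Fin 2) ℂ) →ₗ[ℂ] (PBond (i.1.1.P i.1.2.2) 0 → Matrix (Fin 2) (Fin 2) ℂ) :=
    (toL2 i.1.1 i.1.2.2 (c₀ L)).symm.toLinearMap ∘ₗ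
      (LinearMap.adjoint (Qk i.1.1 i.1.2.1 i.1.2.2 i.2.2.le (c₀ L) (cB L) U₀) ∘ₗ KinvT i.1.1 i.1.2.1 i.1.2.2 i.2.2.le (c₀ L) (cB L) (a L i) ((DeltaEtaSlot i.1.1 i.1.2.1 i.1.2.2 (c₀ L) + TJSlotP i.1.1 i.1.2.1 i.1.2.2 i.2.2.le (c₀ L) (cB L) (a L i))) U₀
        ∘ₗ Qk i.1.1 i.1.2.1 i.1.2.2 i.2.2.le (c₀ L) (cB L) U₀ ∘ₗ GT i.1.1 i.1.2.1 i.1.2.2 i.2.2.le (c₀ L) (cB L) (a L i) ((DeltaEtaSlot i.1.1 i.1.2.1 i.1.2.2 (c₀ L) + TJSlotP i.1.1 i.1.2.1 i.1.2.2 i.2.2.le (c₀ L) (cB L) (a L i))) U₀)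
      ∘ₗ (toL2 i.1.1 i.1.2.2 (c₀ L)).toLinearMap
  have hTlin : ∀ X : PBond (i.1.1.P i.1.2.2) 0 → Matrix (Fin 2) (Fin 2) ℂ, Tlin X
      = (toL2 i.1.1 i.1.2.2 (c₀ L)).symm (LinearMap.adjoint (Qk i.1.1 i.1.2.1 i.1.2.2 i.2.2.le (c₀ L) (cB L) U₀) (KinvT i.1.1 i.1.2.1 i.1.2.2 i.2.2.le (c₀ L) (cB L) (a L i) ((DeltaEtaSlot i.1.1 i.1.2.1 i.1.2.2 (c₀ L) + TJSlotP i.1.1 i.1.2.1 i.1.2.2 i.2.2.le (c₀ L) (cB L) (a L i))) U₀ (Qk i.1.1 i.1.2.1 i.1.2.2 i.2.2.le (c₀ L) (cB L) U₀ (GT i.1.1 i.1.2.1 i.1.2.2 i.2.2.le (c₀ L) (cB L) (a L i) ((DeltaEtaSlot i.1.1 i.1.2.1 i.1.2.2 (c₀ L) + TJSlotP i.1.1 i.1.2.1 i.1.2.2 i.2.2.le (c₀ L) (cB L) (a L i))) U₀ (toL2 i.1.1 i.1.2.2 (c₀ L) X))))) := by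
    intro X
    simp only [Tlin, LinearMap.coe_comp, Function.comp_apply, LinearEquiv.coe_toLinearMap]
  have hx : x = toL2 i.1.1 i.1.2.2 (c₀ L) ((toL2 i.1.1 i.1.2.2 (c₀ L)).symm x) := ((toL2 i.1.1 i.1.2.2 (c₀ L)).apply_symm_apply x).symm
  have h := sup_row_of_kernel_row (F := i.1.1) (n := i.1.2.1) (K := i.1.2.2) Tlin.toAddMonoidHom (hCC L hL) (hδC L hL)
    (fun b Z bd' => by
      rw [LinearMap.toAddMonoidHom_coe, hTlin, hFL']
      exact hCk L hL i U₀ hreg b Z bd') ((toL2 i.1.1 i.1.2.2 (c₀ L)).symm x) (fun b => norm_le_pi_norm _ b) bd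
  rw [LinearMap.toAddMonoidHom_coe, hTlin, ← hx] at h
  exact h

end Family

end Summit.QuantumFields.YangMills.Theorems.Prop7Op137OfKernelRows

end
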